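import Summits.CriticalPhenomena.CardyFormulaZ2.Theorems.CardyIKTransportIKMixedBoxCrossingTransportLinkDefs

/-!
# Stub `stub_linkTelescope` (H5, TELESCOPING) of the link decomposition (line `defect-closure-exploration`,
# reshape v5b, crux `IKMixedBoxCrossing`, stmt-CriticalPhenomena-5911)

Support file (`--supports stmt-CriticalPhenomena-5911`): `LinkTelescope`, i.e. the one-gap trace inequality H4
(`LinkTraceIneq`, a hypothesis) implies, for every necklace `N` and every increasing `Φ`,
`W univ · Σ_x Φ(x) honW x ≤ Σ_x Φ(x) W ∅ x` (memo §9, "telescoping").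

PROOF.  For a set `T` of converted gaps put
`A T := Σ_x Φ(x) · (∏_{j ∈ T} pG (gapLen j) (x j)) · W T x` (the HYBRID SUM).  Then `A ∅` is the right-hand
side and `A univ` the left-hand side (`W univ x` does not depend on `x`).  For `i ∉ T` we show
`A (insert i T) ≤ A T` from three facts: (F1) ADDITIVITY `W (insert i T) x = W T (x[i ↦ true]) + W T (x[i ↦ false])`
(the block of the converted gap `i` is `S^(r-1) F_g = S^(r-1) M¹ + S^(r-1) (F_g - M¹)`, the ordered product is
additive in one entry and so is the trace); (F2) PAIRING of the sum over `x` along the coordinate `i`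
(`Equiv.funSplitAt`); (F3) the POINTWISE comparison of the paired terms, which is trivial when `Φ` takes the same
value at `x[i ↦ true]` and `x[i ↦ false]` and is exactly H4 (times the nonnegative factor `∏_{j ∈ T} pG …`) when
`Φ (x[i ↦ true]) ∧ ¬ Φ (x[i ↦ false])`; monotonicity of `Φ` excludes the fourth case.  Induction on `T` gives
`A univ ≤ A ∅`.
-/

noncomputable section

namespace Summit.CriticalPhenomena.CardyFormulaZ2.Cruxes.IKMixedBoxCrossing.DefectClosureExploration

open scoped BigOperators Classical
open Finset Matrix Function

namespace LinkTelescopeStub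

/-! ### (F1) Additivity of the ordered product and of the trace in one converted gap -/

/-- The ordered product of a `List.ofFn` is additive in each entry. -/
theorem prod_ofFn_add {R : Type*} [Semiring R] :
    ∀ {k : ℕ} (i : Fin k) (F F₁ F₀ : Fin k → R), (∀ j, j ≠ i → F₁ j = F j) →
      (∀ j, j ≠ i → F₀ j = F j) → F i = F₁ i + F₀ i →
        (List.ofFn F).prod = (List.ofFn F₁).prod + (List.ofFn F₀).prod
  | 0, i, _, _, _, _, _, _ => i.elim0
  | k + 1, i, F, F₁, F₀, h₁, h₀, hi => by
      rw [List.ofFn_succ, List.ofFn_succ, List.ofFn_succ, List.prod_cons, List.prod_cons, List.prod_cons]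
      rcases Fin.eq_zero_or_eq_succ i with rfl | ⟨i', rfl⟩
      · have t₁ : (fun j : Fin k => F₁ j.succ) = fun j => F j.succ := funext fun j => h₁ _ (Fin.succ_ne_zero j)
        have t₀ : (fun j : Fin k => F₀ j.succ) = fun j => F j.succ := funext fun j => h₀ _ (Fin.succ_ne_zero j)
        rw [t₁, t₀, hi, add_mul]
      · rw [h₁ 0 (Fin.succ_ne_zero i').symm, h₀ 0 (Fin.succ_ne_zero i').symm,
          prod_ofFn_add i' (fun j : Fin k => F j.succ) (fun j => F₁ j.succ) (fun j => F₀ j.succ)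
            (fun j hj => h₁ _ fun h => hj (Fin.succ_inj.mp h)) (fun j hj => h₀ _ fun h => hj (Fin.succ_inj.mp h))
            hi, mul_add]

variable {L : ℕ} (N : Necklace L)

/-- (F1) Converting one more gap `i ∉ T` splits the trace according to the crossing value at `i`:
`W (insert i T) x = W T (x[i ↦ true]) + W T (x[i ↦ false])`. -/
theorem W_insert (T : Finset (Fin N.k)) (x : Fin N.k → Bool) {i : Fin N.k} (hi : i ∉ T) :
    N.W (insert i T) x = N.W T (update x i true) + N.W T (update x i false) := by
  unfold Necklace.W Necklace.prodMat
  rw [← Matrix.trace_add]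
  congr 1
  refine prod_ofFn_add i _ _ _ (fun j hj => ?_) (fun j hj => ?_) ?_
  · unfold Necklace.block
    rw [update_of_ne hj]
    simp only [Finset.mem_insert, hj, false_or]
  · unfold Necklace.block
    rw [update_of_ne hj]
    simp only [Finset.mem_insert, hj, false_or]
  · unfold Necklace.block
    simp only [Finset.mem_insert_self, if_true, if_neg hi, update_self, Gmat, Bool.false_eq_true, if_false]
    rw [← Matrix.mul_add, add_sub_cancel]

/-- The fully converted trace does not depend on the crossing pattern. -/
theorem W_univ (x : Fin N.k → Bool) : N.W Finset.univ x = N.W Finset.univ (fun _ => true) := by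
  unfold Necklace.W Necklace.prodMat Necklace.block
  simp only [Finset.mem_univ, if_true]

/-! ### (F2) Pairing the crossing patterns along one coordinate -/

/-- Updating the split coordinate of `(Equiv.funSplitAt i Bool).symm (a, y)`. -/
theorem update_funSplitAt_symm {k : ℕ} (i : Fin k) (a b : Bool) (y : {j // j ≠ i} → Bool) :
    update ((Equiv.funSplitAt i Bool).symm (a, y)) i b = (Equiv.funSplitAt i Bool).symm (b, y) := by
  funext j
  by_cases hj : j = i
  · subst hj
    simp [Equiv.funSplitAt_symm_apply]
  · rw [update_of_ne hj]
    simp [Equiv.funSplitAt_symm_apply, hj]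

/-- (F2) Comparing two sums over the crossing patterns pair by pair along the coordinate `i`. -/
theorem sum_le_of_pair_le {k : ℕ} (i : Fin k) (h₁ h₂ : (Fin k → Bool) → ℝ)
    (H : ∀ x, h₁ (update x i true) + h₁ (update x i false) ≤ h₂ (update x i true) + h₂ (update x i false)) :
    ∑ x, h₁ x ≤ ∑ x, h₂ x := by
  have expand : ∀ h : (Fin k → Bool) → ℝ, ∑ x, h x = ∑ y : {j // j ≠ i} → Bool,
      (h (update ((Equiv.funSplitAt i Bool).symm (true, y)) i true) +
        h (update ((Equiv.funSplitAt i Bool).symm (true, y)) i false)) := by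
    intro h
    rw [← (Equiv.funSplitAt i Bool).symm.sum_comp h, Fintype.sum_prod_type_right]
    refine Finset.sum_congr rfl fun y _ => ?_
    rw [Fintype.sum_bool, update_funSplitAt_symm, update_funSplitAt_symm]
  rw [expand h₁, expand h₂]
  exact Finset.sum_le_sum fun y _ => H _

/-! ### (F3) The hybrid sums and the one-gap step -/

/-- `0 ≤ pG g b` (`piG g = 2^{-(g+1)} ≤ 1`). -/
theorem pG_nonneg (g : ℕ) (b : Bool) : 0 ≤ pG g b := by
  unfold pG piG
  cases b
  · simp only [Bool.false_eq_true, if_false, sub_nonneg]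
    exact pow_le_one₀ (by norm_num) (by norm_num)
  · simp only [if_true]
    positivity

/-- THE ONE-GAP STEP for the HYBRID SUMS `Σ_x Φ(x) · (∏_{j ∈ T} pG (gapLen j) (x j)) · W T x`: converting
one more gap `i ∉ T` does not increase the hybrid sum of an increasing `Φ` (uses H4). -/
theorem hyb_insert_le (h4 : LinkTraceIneq) (hL : 3 ≤ L) (Φ : (Fin N.k → Bool) → Prop)
    (hΦ : ∀ x x', x ≤ x' → Φ x → Φ x') (T : Finset (Fin N.k)) {i : Fin N.k} (hi : i ∉ T) :
    (∑ x : Fin N.k → Bool,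
      if Φ x then (∏ j ∈ insert i T, pG (N.gapLen j) (x j)) * N.W (insert i T) x else 0) ≤
        ∑ x : Fin N.k → Bool, if Φ x then (∏ j ∈ T, pG (N.gapLen j) (x j)) * N.W T x else 0 := by
  refine sum_le_of_pair_le i _ _ fun x => ?_
  have h4' := h4 L N T x i hi hL
  set x₁ := update x i true
  set x₀ := update x i false
  set c := ∏ j ∈ T, pG (N.gapLen j) (x j)
  have hc₀ : 0 ≤ c := Finset.prod_nonneg fun j _ => pG_nonneg _ _
  have hcb : ∀ b : Bool, ∏ j ∈ T, pG (N.gapLen j) (update x i b j) = c := fun b =>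
    Finset.prod_congr rfl fun j hj => by rw [update_of_ne (ne_of_mem_of_not_mem hj hi)]
  have hWb : ∀ b : Bool, N.W (insert i T) (update x i b) = N.W T x₁ + N.W T x₀ := fun b => by
    rw [W_insert N T _ hi, update_idem, update_idem]
  have hsum₁ : ∀ b : Bool,
      (∏ j ∈ insert i T, pG (N.gapLen j) (update x i b j)) * N.W (insert i T) (update x i b) =
        pG (N.gapLen i) b * c * (N.W T x₁ + N.W T x₀) := fun b => by
    rw [Finset.prod_insert hi, update_self, hcb, hWb]
  have hle : x₀ ≤ x₁ := update_le_update_iff'.mpr (Bool.false_le _)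
  rw [hsum₁ true, hsum₁ false, hcb true, hcb false]
  set w₁ := N.W T x₁
  set w₀ := N.W T x₀
  have hpt : pG (N.gapLen i) true = piG (N.gapLen i) := rfl
  have hpf : pG (N.gapLen i) false = 1 - piG (N.gapLen i) := rfl
  rw [hpt, hpf]
  by_cases h1 : Φ x₁
  · by_cases h0 : Φ x₀
    · rw [if_pos h1, if_pos h0, if_pos h1, if_pos h0]
      exact le_of_eq (by ring)
    · rw [if_pos h1, if_neg h0, if_pos h1, if_neg h0, add_zero, add_zero]
      calc piG (N.gapLen i) * c * (w₁ + w₀) = c * (piG (N.gapLen i) * (w₁ + w₀)) := by ring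
        _ ≤ c * w₁ := mul_le_mul_of_nonneg_left h4' hc₀
  · have h0 : ¬ Φ x₀ := fun h0 => h1 (hΦ x₀ x₁ hle h0)
    rw [if_neg h1, if_neg h0, if_neg h1, if_neg h0]

/-- TELESCOPING: every hybrid sum is at most the unconverted one. -/
theorem hyb_le_hyb_empty (h4 : LinkTraceIneq) (hL : 3 ≤ L) (Φ : (Fin N.k → Bool) → Prop)
    (hΦ : ∀ x x', x ≤ x' → Φ x → Φ x') (T : Finset (Fin N.k)) :
    (∑ x : Fin N.k → Bool, if Φ x then (∏ j ∈ T, pG (N.gapLen j) (x j)) * N.W T x else 0) ≤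
      ∑ x : Fin N.k → Bool,
        if Φ x then (∏ j ∈ (∅ : Finset (Fin N.k)), pG (N.gapLen j) (x j)) * N.W ∅ x else 0 := by
  induction T using Finset.induction_on with
  | empty => exact le_rfl
  | insert i T hi ih => exact (hyb_insert_le N h4 hL Φ hΦ T hi).trans ih

end LinkTelescopeStub

open LinkTelescopeStub in
/-- **H5 · TELESCOPING** (`LinkTelescope`): the one-gap trace inequality H4 implies, for every increasing `Φ`,
`W univ · Σ_x Φ(x) honW x ≤ Σ_x Φ(x) W ∅ x`. -/
theorem stub_linkTelescope : LinkTelescope := by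
  intro h4 L N hL Φ hΦ
  have key := hyb_le_hyb_empty N h4 hL Φ hΦ Finset.univ
  have hE : (∑ x : Fin N.k → Bool,
      if Φ x then (∏ j ∈ (∅ : Finset (Fin N.k)), pG (N.gapLen j) (x j)) * N.W ∅ x else 0) =
        ∑ x : Fin N.k → Bool, if Φ x then N.W ∅ x else 0 := by
    refine Finset.sum_congr rfl fun x _ => ?_
    rw [Finset.prod_empty, one_mul]
  have hU : (∑ x : Fin N.k → Bool,
      if Φ x then (∏ j ∈ Finset.univ, pG (N.gapLen j) (x j)) * N.W Finset.univ x else 0) =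
        N.W Finset.univ (fun _ => true) * ∑ x : Fin N.k → Bool, if Φ x then N.honW x else 0 := by
    rw [Finset.mul_sum]
    refine Finset.sum_congr rfl fun x _ => ?_
    rw [W_univ N x, mul_ite, mul_zero, mul_comm]
    rfl
  rw [← hE, ← hU]
  exact key

end Summit.CriticalPhenomena.CardyFormulaZ2.Cruxes.IKMixedBoxCrossing.DefectClosureExploration
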